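import Mathlib
import HarnessLib
import Summits.Langlands.Langlands.Theses.SkinnerWilesDefectOne
import Summits.Langlands.Langlands.Theorems.SkinnerWilesDefectOneReducibleOrdinaryProModularDefs

/-!
# `ProModularOfEisensteinSeed` (stmt-Langlands-14718): the per-datum form of the glue

Route `SkinnerWilesDefectOne`, support item stmt-Langlands-14718
(`ProModularOfEisensteinSeed : EisensteinProModularSeed → ReducibleOrdinaryProModular`, "Skinner–Wiles'
Main Theorem at defect one GIVEN their step (II)").

The item is an implication between two CLOSED universal statements.  What Skinner–Wiles actually prove
in steps (I)+(III) ([SW, §4.3 Prop. 4.1, §4.4 Prop. 4.2]) is a PER-DATUM transport: for ONE admissible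
pair `(ρ, ρ₀)`, a pro-modular partner `r` of the same residual type (the output of step (II) for that
residual datum) makes `ρ` itself pro-modular.  This file records, kernel-checked, that the per-datum
transport is SUFFICIENT for the item (`proModularOfEisensteinSeed_of_pointwise`: instantiate the seed at
the same datum) and is in turn implied by the engine crux (`pointwiseGlue_of_engine`: the partner is
discarded), so that the item's open content is bracketed between two typed statements over the route's
landed vocabulary `OrdLoc`/`ProMod` (`…ReducibleOrdinaryProModularDefs`):

  `ReducibleOrdinaryProModular ⟹ PointwiseGlue ⟹ ProModularOfEisensteinSeed`,

where `PointwiseGlue` (written inline below, no new definition) is: for every admissible `(F, p, O, ρ, ρ₀)`,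
IF there are a tame level `𝒰`, an irreducible `p`-adically automorphic `r` of level `𝒰` with an integral
model `r₀` residually congruent to `ρ₀` on the ordered diagonal, oriented-ordinary of some parallel weight,
and one auxiliary place `q` controlling `𝒰.bad` (the seed's conclusion VERBATIM for this datum), THEN
`ProMod p ρ`.  The per-datum statement is the honest shape of "SW (I)+(III) given (II)" and is what a
re-filed crux for this glue should say; its proof at Taylor–Wiles defect `l₀ = 1` is not in print
(see the item's evidence note).  Pure logic over the route declarations; nothing is assumed true. [folklore]

References: C. M. Skinner, A. J. Wiles, *Residually reducible representations and modular forms*,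
Publ. Math. IHÉS 89 (1999), §§4.3–4.4. [SkinnerWiles1999]
-/

set_option linter.dupNamespace false -- project-wide option (lakefile weak.linter.dupNamespace); `Summit.Langlands.Langlands` is the mandated namespace
set_option autoImplicit false

namespace Summit.Langlands.Langlands.Theorems

open scoped NumberField MatrixGroups
open Filter NumberField IsDedekindDomain Field
open Literature.NumberTheory.Automorphic Literature.NumberTheory.Automorphic.BigHeckeGLn
open Literature.NumberTheory.GaloisRepresentations
open Summit.Langlands.Langlands.Theses.SkinnerWilesDefectOne
open Summit.Langlands.Langlands.Cruxes.ReducibleOrdinaryProModular.SteinbergHyperplane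

/-- **The per-datum transport implies the glue item.**  If, for every admissible datum
`(F, p, O, ρ, ρ₀)` of the engine (`OrdLoc` = the crux's local clause at `p`), the existence of a seed
partner `(𝒰, r, r₀, q)` — the conclusion of `EisensteinProModularSeed` for THIS datum, verbatim — implies
`ProMod p ρ`, then `ProModularOfEisensteinSeed` holds: instantiate the seed at the same datum
(Skinner–Wiles' use of step (II) for the residual datum of `ρ`, [SW, §4.4]). [cite: SkinnerWiles1999, §4.4 Prop. 4.2] -/
theorem proModularOfEisensteinSeed_of_pointwise
    (h : ∀ (F : Type) [Field F] [NumberField F], IsTotallyComplex F → Module.finrank ℚ F = 2 →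
      ∀ (p : ℕ) [Fact p.Prime], p ≠ 2 →
      ∀ (O : ValuationSubring (PadicAlgCl p)),
        O = (Valued.v : Valuation (PadicAlgCl p) NNReal).valuationSubring →
      ∀ (ρ : FramedGaloisRep F (PadicAlgCl p) 2) (ρ₀ : absoluteGaloisGroup F →* GL (Fin 2) O),
        ρ.toGaloisRep.IsIrreducible → (∀ᶠ v in cofinite, ρ.IsUnramifiedAt v) →
        ρ.HasUpperTriangularIntegralModel ρ₀ → OrdLoc p O ρ ρ₀ →
        (∃ (𝒰 : TameLevel 2 F p) (r : FramedGaloisRep F (PadicAlgCl p) 2)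
            (r₀ : absoluteGaloisGroup F →* GL (Fin 2) O) (q : HeightOneSpectrum (𝓞 F)),
          r.toGaloisRep.IsIrreducible ∧ 𝒰.IsPadicallyAutomorphic r ∧
          r.HasUpperTriangularIntegralModel r₀ ∧
          (∀ g, ((r₀ g).val 0 0 - (ρ₀ g).val 0 0 : O) ∈ IsLocalRing.maximalIdeal O ∧
            ((r₀ g).val 1 1 - (ρ₀ g).val 1 1 : O) ∈ IsLocalRing.maximalIdeal O) ∧
          (∃ k : ℕ, 2 ≤ k ∧ ∃ m : ℕ, 0 < m ∧
            ∀ v : HeightOneSpectrum (𝓞 F), (p : 𝓞 F) ∈ v.asIdeal →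
              ∃ Q : Matrix.GeneralLinearGroup (Fin 2) (PadicAlgCl p),
                Valued.v (Q.val 0 0) ≤ Valued.v (Q.val 1 0) ∧
                ∀ σ, (Q⁻¹ * r.toLocal v σ * Q).val 1 0 = 0 ∧
                  (σ ∈ absInertia (v.adicCompletion F) →
                    (Q⁻¹ * r.toLocal v σ * Q).val 1 1 ^ m = 1 ∧
                    (Q⁻¹ * r.toLocal v σ * Q).val 0 0 ^ m =
                      algebraMap (Padic p) (PadicAlgCl p)
                        (((GaloisRep.cyclotomicCharacter (v.adicCompletion F) p σ).val :
                          PadicInt p) : Padic p) ^ ((k - 1) * m))) ∧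
          (∀ v : HeightOneSpectrum (𝓞 F), v ≠ q → (p : 𝓞 F) ∉ v.asIdeal →
            (∀ 𝔓 ∈ v.primesAbove, ∀ σ ∈ 𝔓.inertia (absoluteGaloisGroup F),
              ((ρ₀ σ).val 0 0 - 1 : O) ∈ IsLocalRing.maximalIdeal O ∧
              ((ρ₀ σ).val 1 1 - 1 : O) ∈ IsLocalRing.maximalIdeal O) → v ∉ 𝒰.bad)) →
        ProMod p ρ) :
    ProModularOfEisensteinSeed := by
  intro hS F _ _ hF hdeg p _ hp O hO ρ ρ₀ hirr hunr hmod hloc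
  exact h F hF hdeg p hp O hO ρ ρ₀ hirr hunr hmod hloc
    (hS F hF hdeg p hp O hO ρ ρ₀ hirr hunr hmod hloc)

/-- **The engine crux implies the per-datum transport** (the partner is discarded): the per-datum
statement of `proModularOfEisensteinSeed_of_pointwise` is no stronger than `ReducibleOrdinaryProModular`
(stmt-Langlands-12919), so the item's open content lies between the two. [folklore] -/
theorem pointwiseGlue_of_engine (hE : ReducibleOrdinaryProModular) :
    ∀ (F : Type) [Field F] [NumberField F], IsTotallyComplex F → Module.finrank ℚ F = 2 →
      ∀ (p : ℕ) [Fact p.Prime], p ≠ 2 →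
      ∀ (O : ValuationSubring (PadicAlgCl p)),
        O = (Valued.v : Valuation (PadicAlgCl p) NNReal).valuationSubring →
      ∀ (ρ : FramedGaloisRep F (PadicAlgCl p) 2) (ρ₀ : absoluteGaloisGroup F →* GL (Fin 2) O),
        ρ.toGaloisRep.IsIrreducible → (∀ᶠ v in cofinite, ρ.IsUnramifiedAt v) →
        ρ.HasUpperTriangularIntegralModel ρ₀ → OrdLoc p O ρ ρ₀ →
        (∃ (𝒰 : TameLevel 2 F p) (r : FramedGaloisRep F (PadicAlgCl p) 2)
            (r₀ : absoluteGaloisGroup F →* GL (Fin 2) O) (q : HeightOneSpectrum (𝓞 F)),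
          r.toGaloisRep.IsIrreducible ∧ 𝒰.IsPadicallyAutomorphic r ∧
          r.HasUpperTriangularIntegralModel r₀ ∧
          (∀ g, ((r₀ g).val 0 0 - (ρ₀ g).val 0 0 : O) ∈ IsLocalRing.maximalIdeal O ∧
            ((r₀ g).val 1 1 - (ρ₀ g).val 1 1 : O) ∈ IsLocalRing.maximalIdeal O) ∧
          (∃ k : ℕ, 2 ≤ k ∧ ∃ m : ℕ, 0 < m ∧
            ∀ v : HeightOneSpectrum (𝓞 F), (p : 𝓞 F) ∈ v.asIdeal →
              ∃ Q : Matrix.GeneralLinearGroup (Fin 2) (PadicAlgCl p),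
                Valued.v (Q.val 0 0) ≤ Valued.v (Q.val 1 0) ∧
                ∀ σ, (Q⁻¹ * r.toLocal v σ * Q).val 1 0 = 0 ∧
                  (σ ∈ absInertia (v.adicCompletion F) →
                    (Q⁻¹ * r.toLocal v σ * Q).val 1 1 ^ m = 1 ∧
                    (Q⁻¹ * r.toLocal v σ * Q).val 0 0 ^ m =
                      algebraMap (Padic p) (PadicAlgCl p)
                        (((GaloisRep.cyclotomicCharacter (v.adicCompletion F) p σ).val :
                          PadicInt p) : Padic p) ^ ((k - 1) * m))) ∧
          (∀ v : HeightOneSpectrum (𝓞 F), v ≠ q → (p : 𝓞 F) ∉ v.asIdeal →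
            (∀ 𝔓 ∈ v.primesAbove, ∀ σ ∈ 𝔓.inertia (absoluteGaloisGroup F),
              ((ρ₀ σ).val 0 0 - 1 : O) ∈ IsLocalRing.maximalIdeal O ∧
              ((ρ₀ σ).val 1 1 - 1 : O) ∈ IsLocalRing.maximalIdeal O) → v ∉ 𝒰.bad)) →
        ProMod p ρ := by
  intro F _ _ hF hdeg p _ hp O hO ρ ρ₀ hirr hunr hmod hloc _
  exact (crux_iff.mp hE) F hF hdeg p hp O hO ρ ρ₀ hirr hunr hmod hloc

end Summit.Langlands.Langlands.Theorems
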